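import Summits.BirchSwinnertonDyer.BirchSwinnertonDyer.Theorems.GenusKolyvaginAtTwoGenusPrimitiveSupplyAtTwoGenusField
import Summits.BirchSwinnertonDyer.BirchSwinnertonDyer.Theorems.GenusKolyvaginAtTwoGenusPrimitiveSupplyAtTwoMultiGenusField
import Summits.BirchSwinnertonDyer.BirchSwinnertonDyer.Theorems.KolyvaginRoadThreePointCertificate

/-!
# Route `GenusKolyvaginAtTwo`, crux `GenusPrimitiveSupplyAtTwo` (stmt-BirchSwinnertonDyer-22136), line `genus-supply`:
# the crux's certificate `P(n) ∉ 2E(K[n])` IS a non-zero Kolyvagin class `c₁(n) ≠ 0 ∈ H¹(K, E[2])` —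
# admissibility of `E(K[n]) ⊆ E(K̄)` AT `p = 2`, and McCallum's Cor. 4.5 both ways at `2`

Lead prover seat bsd-line-gk2-p1 (g3). THEOREMS ONLY; nothing about Kolyvagin's conjecture at `2` is asserted; the crux stays
OPEN; BSD is not proved by any of this.

WHY. The open kernel U of crux 22136 («some Kolyvagin derived point `P(n)`, `n` square-free of Kolyvagin primes at `2`, is not
`2`-divisible in `E(K[n])`», equivalently the multi-genus trace form, `…MultiGenusField`) and the open child
`KolyvaginNonvanishingAtTwo` (stmt-BirchSwinnertonDyer-23948) of crux 19220 `RankOneTwoConverse` (route `TwoAdicConverse`) —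
whose widening (CONV₂) is the OTHER open kernel of 22136 — are the SAME kind of statement: a non-zero Kolyvagin class
`c_M(n) = d.kolyvaginClass Nat.prime_two M ≠ 0`. The tree's passage between the two currencies (`KolyCert.kolyvaginClass_ne_zero_iff`,
McCallum 1991 Cor. 4.5 / Gross 1991 Prop. 4.7 (1)) needs two standing inputs: (hA) `E(K[n]) ⊆ E(K̄)` admissible for `p^M`
(Gross Lemma 4.3 — the tree's supplier `RingClassNoTorsion.isAdmissible_pointsSubgroup` REQUIRES `p ≠ 2`) and (hP) `[P(n)]`
`Γ_K`-invariant mod `p^M` (Gross Prop. 3.6 — tree `KolyCert.toGeomPoints_derivedPoint_mem_invPoints_of_dvd_zhang`, any `p`).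
This file supplies (hA) AT `p = 2` on the crux's frames (`ρ̄_{E,2}` onto, `d_K` odd, Heegner hypothesis: `E(K[n])[2] = 0` is the
U2 track's PROVED `forall_two_nsmul_eq_zero_of_heegner`, here `…GenusField.heegner_two_torsion_free`) and concludes:
* §1 `heegner_two_pow_torsion_free`, `isAdmissible_pointsSubgroup_two` — `E(K[n])[2^M] = 0` and the (hA) binder at `p = 2`
  (used by 22136, 22137 `KolyvaginExactAtTwo`, 23948, 23949 `KolyvaginCorankRigidityAtTwo` alike);
* §2 `kolyvaginClass_two_ne_zero_iff_not_two_dvd` — for Kolyvagin–Heegner data at the divisors of a square-free product `n` of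
  Kolyvagin primes at `2`: `c₁(n) ≠ 0 ⟺ P(n) ∉ 2E(K[n])` (McCallum Cor. 4.5 both ways at `p = 2`, `M = 1`), and the `M`-level
  version `c_M(n) ≠ 0 ⟺ 2^M ∤ P(n)` for `M ≤ M(n)`;
* §3 `kolyvaginNonvanishing_two_of_certificate` — the crux's certificate clause, read on such a family, yields the CONCLUSION
  SHAPE of `Theses.TwoAdicConverse.KolyvaginNonvanishingAtTwo` for `(E, K)`: `KolSupp … n ∧ 1 ≤ 1 ∧ 1 ≤ M(n) ∧ c₁(n) ≠ 0`;
  `…_of_multiGenusTrace` — the same from the U-form (multi-genus trace `2`-primitive).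
READING (planner-of-record): U (22136) ⟹ Kolyvagin's conjecture at `2` for the same `(E, K)` with `M = 1` at a level where
moreover `M_∞ = 0`; the two routes' open Heegner kernels at `2` are one family («Kolyvagin `2`-primitivity»), U being its
`M = 1 ∧ M_∞ = 0` member on the habitat. Helper (`--supports stmt-BirchSwinnertonDyer-22136`).
-/

set_option linter.dupNamespace false -- tree convention: `Summit.BirchSwinnertonDyer.BirchSwinnertonDyer.Theorems` (summit = sub-problem)

noncomputable section

open scoped Classical

namespace Summit.BirchSwinnertonDyer.BirchSwinnertonDyer.Theorems.GenusKoly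

open Finset NumberField WeierstrassCurve Field Literature.NumberTheory.EllipticCurves
  Literature.NumberTheory.EllipticCurves.ModularForms Literature.NumberTheory.EllipticCurves.KolyvaginCocycle
  Summit.BirchSwinnertonDyer.Rank1Residual.X11b

section Heegner

variable {W : WeierstrassCurve ℚ} [NeZero (W.conductorNorm ℤ)] {K : Type} [Field K] [NumberField K]
  {Dt : ModularParametrizationData W (W.conductorNorm ℤ)} {β : ℤ} {ι : K →+* ℂ}

/-! ## §1 `E(K[n])[2^M] = 0` and admissibility of `E(K[n]) ⊆ E(K̄)` for `2^M` -/

omit [NeZero (W.conductorNorm ℤ)] in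
/-- **`E(K[n])[2^M] = 0`** on the crux's frames (`W` globally minimal, `ρ̄_{E,2}` onto, `K` imaginary quadratic with odd `d_K`
and the Heegner hypothesis, `n ≠ 0`): induction on `M` from `E(K[n])[2] = 0` (`heegner_two_torsion_free`, Gross's Lemma 4.3
at `p = 2`). [cite: GrossLMS1991, §4, Lemma 4.3] [cite: McCallumLMS1991, §4 (5)] -/
theorem heegner_two_pow_torsion_free [W.IsElliptic] [W.IsGloballyMinimal] (hK : IsImaginaryQuadratic K)
    (hodd : Odd (NumberField.discr K)) (hH : SatisfiesHeegnerHypothesis (W.conductorNorm ℤ) K)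
    (hsurj : W.HasSurjectiveModNGaloisRep ((2 : ℤ) ^ 1)) {n : ℕ} (hn : n ≠ 0) (M : ℕ)
    (Q : (W.baseChange (ringClassField K ι n)).toAffine.Point) (hQ : ((2 ^ M : ℕ) : ℤ) • Q = 0) : Q = 0 := by
  induction M generalizing Q with
  | zero => simpa using hQ
  | succ M ih =>
    have h : (2 : ℤ) • (((2 ^ M : ℕ) : ℤ) • Q) = 0 := by
      rw [smul_smul, ← hQ]
      congr 1
      push_cast
      ring
    exact ih Q (heegner_two_torsion_free (ι := ι) hK hodd hH hsurj hn _ h)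

/-- **The (hA) binder AT `p = 2`** — admissibility of `E(K[n]) ⊆ E(K̄)` for `2^M` (McCallum 1991 §4 (5) «`E` has no `K_n`-rational
`p`-torsion», Gross 1991 Lemma 4.3 and (4.2)): for a concrete Kolyvagin–Heegner datum `d` of conductor `n ≠ 0` on the crux's frame,
`d.pointsSubgroup ⊆ E(K̄)` is `Γ_K`-stable (`RingClassNoTorsion.smul_toGeomPoints_eq`, any `p`) and `2^M`-torsion-free (§1). The
tree's `RingClassNoTorsion.isAdmissible_pointsSubgroup` covers `p ≠ 2` only; this is its `p = 2` companion (inputs: `ρ̄_{E,2}` onto,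
`d_K` odd, Heegner hypothesis). [cite: McCallumLMS1991, §4 (5)] [cite: GrossLMS1991, §4, Lemma 4.3 and (4.2)] -/
theorem isAdmissible_pointsSubgroup_two [W.IsElliptic] [W.IsGloballyMinimal] (hK : IsImaginaryQuadratic K)
    (hodd : Odd (NumberField.discr K)) (hH : SatisfiesHeegnerHypothesis (W.conductorNorm ℤ) K)
    (hsurj : W.HasSurjectiveModNGaloisRep ((2 : ℤ) ^ 1)) {n : ℕ} (hn : n ≠ 0) (d : KolyvaginHeegnerData Dt β ι n) (M : ℕ) :
    IsAdmissible (absoluteGaloisGroup K) d.pointsSubgroup ((2 ^ M : ℕ) : ℤ) where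
  smul_mem g := by
    rintro _ ⟨P, rfl⟩
    exact ⟨_, (RingClassNoTorsion.smul_toGeomPoints_eq d hK hn g P).symm⟩
  eq_zero_of_zsmul := by
    rintro _ ⟨P, rfl⟩ hP
    rw [← map_zsmul] at hP
    have hP0 : ((2 ^ M : ℕ) : ℤ) • P = 0 :=
      (Affine.Point.map_injective (W' := W) d.emb.toRatAlgHom) (by rw [map_zero]; exact hP)
    rw [heegner_two_pow_torsion_free hK hodd hH hsurj hn M P hP0, map_zero]

/-! ## §2 McCallum's Cor. 4.5 both ways at `p = 2`: `c_M(n) ≠ 0 ⟺ 2^M ∤ P(n)` -/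

omit [NeZero (W.conductorNorm ℤ)] in
/-- `(N_E, d_K) = 1` in `ℤ`-currency under the Heegner hypothesis (every `q ∣ N_E` splits in `K`). [folklore] -/
theorem heegner_isCoprime_conductorNorm_discr (hK : IsImaginaryQuadratic K)
    (hH : SatisfiesHeegnerHypothesis (W.conductorNorm ℤ) K) :
    IsCoprime ((W.conductorNorm ℤ : ℕ) : ℤ) (NumberField.discr K) := by
  have h := Literature.SatisfiesHeegnerHypothesis.coprime_discr hK.1 hH
  refine Int.isCoprime_iff_gcd_eq_one.mpr ?_
  rw [Int.gcd_eq_natAbs, Int.natAbs_natCast]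
  exact h

/-- **`c_M(n) ≠ 0 ⟺ 2^M ∤ P(n)` in `E(K[n])`** (McCallum 1991 Cor. 4.5 «`c_M(n)` is trivial iff `P_n ∈ p^M E(K_n)`» AT `p = 2`):
for `W` globally minimal with `ρ̄_{E,2}` onto, `K` imaginary quadratic with odd `d_K ≠ −3` and the Heegner hypothesis, `n` a
square-free product of Kolyvagin primes at `2` each of Kolyvagin index `≥ M` (`2^M ∣ ℓ + 1`, `2^M ∣ a_ℓ`), and Kolyvagin–Heegner
data `d m` at every `m ∣ n`: the class `c_M(n) = (d n).kolyvaginClass Nat.prime_two M` of the TOP datum is non-zero iff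
`2^M ∤ P(n)`. Both standing inputs of the cocycle are DISCHARGED: (hA) by `isAdmissible_pointsSubgroup_two`, (hP) by
`KolyCert.toGeomPoints_derivedPoint_mem_invPoints_of_dvd_zhang` (Gross Prop. 3.6 at Zhang–Kolyvagin levels, any `p`).
[cite: McCallumLMS1991, §4 (4)–(6), Cor. 4.5] [cite: GrossLMS1991, Prop. 3.6, Prop. 4.7 (1), Lemma 4.3] -/
theorem kolyvaginClass_two_ne_zero_iff_not_pow_dvd [W.IsElliptic] [W.IsGloballyMinimal] (hK : IsImaginaryQuadratic K)
    (hodd : Odd (NumberField.discr K)) (h3 : NumberField.discr K ≠ -3)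
    (hH : SatisfiesHeegnerHypothesis (W.conductorNorm ℤ) K) (hsurj : W.HasSurjectiveModNGaloisRep ((2 : ℤ) ^ 1))
    {n M : ℕ} (hn : Squarefree n)
    (hkol : ∀ q ∈ n.primeFactors,
      Zhang2014.IsKolyvaginPrime (W.conductorNorm ℤ) W K 2 q ∧ M ≤ Zhang2014.kolyvaginIndex W 2 q)
    (d : (m : ℕ) → m ∣ n → KolyvaginHeegnerData Dt β ι m) :
    (d n dvd_rfl).kolyvaginClass Nat.prime_two M ≠ 0 ↔
      ¬ ∃ Q : (W.baseChange (ringClassField K ι n)).toAffine.Point, ((2 ^ M : ℕ) : ℤ) • Q = (d n dvd_rfl).derivedPoint := by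
  have hA := isAdmissible_pointsSubgroup_two hK hodd hH hsurj hn.ne_zero (d n dvd_rfl) M
  have hP := Three.KolyCert.toGeomPoints_derivedPoint_mem_invPoints_of_dvd_zhang hK ι Dt Nat.prime_two
    (heegner_isCoprime_conductorNorm_discr hK hH) (discr_lt_neg_four_of_odd hK hodd h3) hn hkol d n dvd_rfl
  rw [Ne, Three.KolyCert.kolyvaginClass_eq_zero_iff_pDiv (d n dvd_rfl) Nat.prime_two M hA hP]
  rfl

/-- **`c₁(n) ≠ 0 ⟺ P(n) ∉ 2E(K[n])`** — the `M = 1` case, where «Kolyvagin index `≥ 1`» is exactly «Kolyvagin prime at `2`»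
(`Zhang2014.IsKolyvaginPrime … 2 ℓ`: `ℓ ∤ 2 N_E d_K` inert with `2 ∣ ℓ + 1`, `2 ∣ a_ℓ`). The right-hand side is VERBATIM the
certificate clause of crux 22136 / stub C of line `genus-supply`. [cite: McCallumLMS1991, Cor. 4.5] [cite: GrossLMS1991, Prop. 4.7 (1)] -/
theorem kolyvaginClass_two_ne_zero_iff_not_two_dvd [W.IsElliptic] [W.IsGloballyMinimal] (hK : IsImaginaryQuadratic K)
    (hodd : Odd (NumberField.discr K)) (h3 : NumberField.discr K ≠ -3)
    (hH : SatisfiesHeegnerHypothesis (W.conductorNorm ℤ) K) (hsurj : W.HasSurjectiveModNGaloisRep ((2 : ℤ) ^ 1))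
    {n : ℕ} (hn : Squarefree n) (hkol : ∀ q ∈ n.primeFactors, Zhang2014.IsKolyvaginPrime (W.conductorNorm ℤ) W K 2 q)
    (d : (m : ℕ) → m ∣ n → KolyvaginHeegnerData Dt β ι m) :
    (d n dvd_rfl).kolyvaginClass Nat.prime_two 1 ≠ 0 ↔
      ¬ ∃ Q : (W.baseChange (ringClassField K ι n)).toAffine.Point, (2 : ℤ) • Q = (d n dvd_rfl).derivedPoint := by
  rw [kolyvaginClass_two_ne_zero_iff_not_pow_dvd hK hodd h3 hH hsurj hn (fun q hq ↦ ⟨hkol q hq, (hkol q hq).2.2.2.2.2⟩) d]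
  simp only [pow_one, Nat.cast_ofNat]

/-! ## §3 The crux's certificate as a `KolyvaginNonvanishingAtTwo`-shaped conclusion for `(E, K)` -/

/-- **Certificate ⟹ Kolyvagin non-vanishing at `2` (conclusion shape of item 23948, for the same `(E, K)`).** On the crux's frame,
Kolyvagin–Heegner data at the divisors of a square-free product `n` of Kolyvagin primes at `2` whose top derived point is
`2`-primitive give `KolSupp (IsKolyvaginPrime N_E W K 2) n ∧ 1 ≤ 1 ∧ (1 : ℕ∞) ≤ M(n) ∧ c₁(n) ≠ 0` — literally the matrix of
`Summit.…Theses.TwoAdicConverse.KolyvaginNonvanishingAtTwo` at `(Dt, β, ι, n, d n, M = 1)` (that item's extra hypotheses —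
reduction type at `2`, `2` split in `K`, `E(K)[2] = 0` — play no role in the conclusion). So the open kernel U of 22136 is a
STRENGTHENING (`M = 1`, and `M_∞ = 0` in McCallum's terms) of Kolyvagin's conjecture at `2` for `(E, K)`, the open kernel of
19220/23948. [cite: McCallumLMS1991, Cor. 4.5, §5] [cite: GrossLMS1991, Prop. 4.7 (1)] [cite: WZhang2014, Notations (xii)] -/
theorem kolyvaginNonvanishing_two_of_certificate [W.IsElliptic] [W.IsGloballyMinimal] (hK : IsImaginaryQuadratic K)
    (hodd : Odd (NumberField.discr K)) (h3 : NumberField.discr K ≠ -3)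
    (hH : SatisfiesHeegnerHypothesis (W.conductorNorm ℤ) K) (hsurj : W.HasSurjectiveModNGaloisRep ((2 : ℤ) ^ 1))
    {n : ℕ} (hn : Squarefree n) (hkol : ∀ q ∈ n.primeFactors, Zhang2014.IsKolyvaginPrime (W.conductorNorm ℤ) W K 2 q)
    (d : (m : ℕ) → m ∣ n → KolyvaginHeegnerData Dt β ι m)
    (hcert : ¬ ∃ Q : (W.baseChange (ringClassField K ι n)).toAffine.Point, (2 : ℤ) • Q = (d n dvd_rfl).derivedPoint) :
    KolyvaginDescent.KolSupp (Zhang2014.IsKolyvaginPrime (W.conductorNorm ℤ) W K 2) n ∧ 1 ≤ 1 ∧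
      ((1 : ℕ) : ℕ∞) ≤ Zhang2014.levelIndex W 2 n ∧ (d n dvd_rfl).kolyvaginClass Nat.prime_two 1 ≠ 0 :=
  ⟨⟨hn, hkol⟩, le_rfl, Zhang2014.natCast_le_levelIndex_iff.mpr fun q hq ↦ (hkol q hq).2.2.2.2.2,
    (kolyvaginClass_two_ne_zero_iff_not_two_dvd hK hodd h3 hH hsurj hn hkol d).mpr hcert⟩

/-- **U-form ⟹ Kolyvagin non-vanishing at `2`.** Same frame; if the MULTI-GENUS TRACE `Σ_{g ∈ T} g·y(n)`
(`T = Gal(K[n]/K(√ℓ₁*,…,√ℓ_r*))`, the open kernel U of crux 22136 in the intrinsic currency of `…MultiGenusField`) of the top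
datum is not `2`-divisible in `E(K[n])`, then `c₁(n) ≠ 0` with `KolSupp … n` and `1 ≤ M(n)`.
[cite: McCallumLMS1991, Cor. 4.5] [cite: GrossLMS1991, §3 (3.5), Prop. 3.7 (1), §4 (4.1), Prop. 4.7 (1)] [cite: Cox2013, Thm. 9.18] -/
theorem kolyvaginNonvanishing_two_of_multiGenusTrace [W.IsElliptic] [W.IsGloballyMinimal] (hK : IsImaginaryQuadratic K)
    (hodd : Odd (NumberField.discr K)) (h3 : NumberField.discr K ≠ -3)
    (hH : SatisfiesHeegnerHypothesis (W.conductorNorm ℤ) K) (hsurj : W.HasSurjectiveModNGaloisRep ((2 : ℤ) ^ 1))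
    {n : ℕ} (hn : Squarefree n) (hkol : ∀ q ∈ n.primeFactors, Zhang2014.IsKolyvaginPrime (W.conductorNorm ℤ) W K 2 q)
    (d : (m : ℕ) → m ∣ n → KolyvaginHeegnerData Dt β ι m) {θ : ℕ → ringClassField K ι n}
    (hθ : ∀ ℓ ∈ n.primeFactors, θ ℓ ^ 2 = algebraMap ℚ (ringClassField K ι n) ((-1 : ℚ) ^ (ℓ / 2) * ℓ))
    (T : Finset (ringClassField K ι n ≃ₐ[ℚ] ringClassField K ι n))
    (hT : ∀ g, g ∈ T ↔ g ∈ ringClassGal ι n ∧ ∀ ℓ ∈ n.primeFactors, g (θ ℓ) = θ ℓ)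
    (hU : ¬ ∃ Q : (W.baseChange (ringClassField K ι n)).toAffine.Point, (2 : ℤ) • Q =
      ∑ g ∈ T, pointGalHom W (ringClassField K ι n) g (d n dvd_rfl).y) :
    KolyvaginDescent.KolSupp (Zhang2014.IsKolyvaginPrime (W.conductorNorm ℤ) W K 2) n ∧ 1 ≤ 1 ∧
      ((1 : ℕ) : ℕ∞) ≤ Zhang2014.levelIndex W 2 n ∧ (d n dvd_rfl).kolyvaginClass Nat.prime_two 1 ≠ 0 :=
  kolyvaginNonvanishing_two_of_certificate hK hodd h3 hH hsurj hn hkol d fun hP ↦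
    hU ((heegner_exists_two_zsmul_eq_derivedPoint_iff_multiGenusTrace hK (discr_lt_neg_four_of_odd hK hodd h3) hH hn hkol
      (d n dvd_rfl) hθ T hT).mp hP)

end Heegner

/-! ## §4 (APPEND, same seat g3) PRIME LEVEL in the crux's own witness shape: data `d₁` (conductor `1`) and `d` (conductor `ℓ`) -/

section PrimeLevel

variable {W : WeierstrassCurve ℚ} [NeZero (W.conductorNorm ℤ)] {K : Type} [Field K] [NumberField K]
  {Dt : ModularParametrizationData W (W.conductorNorm ℤ)} {β : ℤ} {ι : K →+* ℂ}

/-- **At a PRIME level the crux's own data suffice**: the crux `GenusPrimitiveSupplyAtTwo` exhibits a conductor-`1` datum `d₁` and a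
level-`n` datum `d`; for `n = ℓ` prime these ARE data at every divisor of `ℓ`, so (§2–§3) `c₁(ℓ) ≠ 0 ⟺ P(ℓ) ∉ 2E(K[ℓ])` and a
`2`-primitive `P(ℓ)` is a `KolyvaginNonvanishingAtTwo`-shaped certificate for `(E, K)` — no family hypothesis left.
[cite: McCallumLMS1991, Cor. 4.5] [cite: GrossLMS1991, Prop. 3.6, Prop. 4.7 (1), Lemma 4.3] -/
theorem kolyvaginClass_two_ne_zero_iff_not_two_dvd_prime [W.IsElliptic] [W.IsGloballyMinimal] (hK : IsImaginaryQuadratic K)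
    (hodd : Odd (NumberField.discr K)) (h3 : NumberField.discr K ≠ -3)
    (hH : SatisfiesHeegnerHypothesis (W.conductorNorm ℤ) K) (hsurj : W.HasSurjectiveModNGaloisRep ((2 : ℤ) ^ 1))
    {ℓ : ℕ} (hKoly : Zhang2014.IsKolyvaginPrime (W.conductorNorm ℤ) W K 2 ℓ)
    (d₁ : KolyvaginHeegnerData Dt β ι 1) (d : KolyvaginHeegnerData Dt β ι ℓ) :
    d.kolyvaginClass Nat.prime_two 1 ≠ 0 ↔
      ¬ ∃ Q : (W.baseChange (ringClassField K ι ℓ)).toAffine.Point, (2 : ℤ) • Q = d.derivedPoint := by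
  have hℓ : ℓ.Prime := hKoly.1
  have hℓ1 : ℓ ≠ 1 := hℓ.ne_one
  -- the crux's two data as a family over the divisors `{1, ℓ}` of `ℓ`
  let fam : (m : ℕ) → m ∣ ℓ → KolyvaginHeegnerData Dt β ι m := fun m hm ↦
    if h : m = ℓ then h ▸ d else ((Nat.dvd_prime hℓ).mp hm).resolve_right h ▸ d₁
  have hfam : fam ℓ dvd_rfl = d := by simp [fam]
  have hkol : ∀ q ∈ ℓ.primeFactors, Zhang2014.IsKolyvaginPrime (W.conductorNorm ℤ) W K 2 q := by
    intro q hq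
    rw [hℓ.primeFactors, Finset.mem_singleton] at hq
    exact hq ▸ hKoly
  have h := kolyvaginClass_two_ne_zero_iff_not_two_dvd hK hodd h3 hH hsurj hℓ.squarefree hkol fam
  rwa [hfam] at h

/-- **A `2`-primitive `P(ℓ)` at a Kolyvagin prime at `2` is a non-zero Kolyvagin class `c₁(ℓ) ∈ H¹(K, E[2])`** — the
`KolyvaginNonvanishingAtTwo` (23948) conclusion shape for `(E, K)` at `(n, M) = (ℓ, 1)`, from the crux's own witness data.
[cite: McCallumLMS1991, Cor. 4.5] [cite: WZhang2014, Notations (xii)] -/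
theorem kolyvaginNonvanishing_two_of_certificate_prime [W.IsElliptic] [W.IsGloballyMinimal] (hK : IsImaginaryQuadratic K)
    (hodd : Odd (NumberField.discr K)) (h3 : NumberField.discr K ≠ -3)
    (hH : SatisfiesHeegnerHypothesis (W.conductorNorm ℤ) K) (hsurj : W.HasSurjectiveModNGaloisRep ((2 : ℤ) ^ 1))
    {ℓ : ℕ} (hKoly : Zhang2014.IsKolyvaginPrime (W.conductorNorm ℤ) W K 2 ℓ)
    (d₁ : KolyvaginHeegnerData Dt β ι 1) (d : KolyvaginHeegnerData Dt β ι ℓ)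
    (hcert : ¬ ∃ Q : (W.baseChange (ringClassField K ι ℓ)).toAffine.Point, (2 : ℤ) • Q = d.derivedPoint) :
    KolyvaginDescent.KolSupp (Zhang2014.IsKolyvaginPrime (W.conductorNorm ℤ) W K 2) ℓ ∧ 1 ≤ 1 ∧
      ((1 : ℕ) : ℕ∞) ≤ Zhang2014.levelIndex W 2 ℓ ∧ d.kolyvaginClass Nat.prime_two 1 ≠ 0 := by
  have hℓ : ℓ.Prime := hKoly.1
  refine ⟨KolyvaginDescent.kolSupp_prime hℓ hKoly, le_rfl, Zhang2014.natCast_le_levelIndex_iff.mpr fun q hq ↦ ?_,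
    (kolyvaginClass_two_ne_zero_iff_not_two_dvd_prime hK hodd h3 hH hsurj hKoly d₁ d).mpr hcert⟩
  rw [hℓ.primeFactors, Finset.mem_singleton] at hq
  exact hq ▸ hKoly.2.2.2.2.2

end PrimeLevel

end Summit.BirchSwinnertonDyer.BirchSwinnertonDyer.Theorems.GenusKoly

end
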